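import Literature.Analysis.FluidPDE.LerayHopf
import HarnessLib

/-!
# Tightness of the junk-model fact: slices of a Leray–Hopf solution at positive times are pinned

Negative-lane record (decomp-ad crit-1 g23), companion of `SliceZeroEject.lean` (`sliceZero_eject`: the
time-zero slice of `Torus.IsGlobalLerayHopf` is free).  Here: the freedom is confined to `t = 0`.  By the
weak-continuity clause of `Torus.IsLerayHopfOn` (`t ↦ ∫⟪u t, w⟫` continuous on `(0, T]` for every `w ∈ L²`),
two Leray–Hopf solutions on `[0, T]` — with possibly different viscosities, forces and data — that agree on a
left neighbourhood `(0, t₀)` of a time `0 < t₀ ≤ T` have the same `L²` pairings at `t₀`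
(`slicePairing_eq_of_eqOn_Ioo`), hence a.e.-equal slices at `t₀` (`slice_ae_eq_of_eqOn_Ioo`); in particular a
solution cannot be altered at a single positive time except on a null set (`slice_ae_eq_of_eq_off`,
`sliceGlobal_ae_eq_of_eq_off`).  Consequence for the lens-4 ejection items (30314 · 30320 · 31392 · 31393 ·
31394 · 32462): the repaired conclusions `∃ t : ℝ, 0 < t ∧ 0 < defect (u t) ∧ …` are immune to the slice
witness of `sliceZero_eject`, the defect functional being invariant under a.e.-modification of the field.
References no `Theses` declaration.
-/

noncomputable section

set_option linter.dupNamespace false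

namespace Summit.AnomalousDissipation.AnomalousDissipation.Theorems.SymmetricOrLoudPlanarStatesEject.Negative

open MeasureTheory Filter Set Topology
open scoped InnerProductSpace
open Literature.Analysis.FluidPDE.Torus

variable {d : Type*} [Fintype d] [DecidableEq d]
variable {T ν ν' t₀ : ℝ} {F F' : ℝ → UnitAddTorus d → EuclideanSpace ℝ d}
  {v₀ v₀' : UnitAddTorus d → EuclideanSpace ℝ d} {u u' : ℝ → UnitAddTorus d → EuclideanSpace ℝ d}

/-- **Pairings at a positive time are pinned from the left.**  If two Leray–Hopf solutions on `[0, T]` agree on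
`(0, t₀)` with `0 < t₀ ≤ T`, then `∫⟪u t₀, w⟫ = ∫⟪u' t₀, w⟫` for every `w ∈ L²` (weak continuity on `(0, T]`
and uniqueness of limits along the non-trivial filter `𝓝[(0, t₀)] t₀`). [folklore] -/
theorem slicePairing_eq_of_eqOn_Ioo (hu : IsLerayHopfOn T ν F v₀ u) (hu' : IsLerayHopfOn T ν' F' v₀' u')
    (ht₀ : 0 < t₀) (ht₀T : t₀ ≤ T) (h : ∀ t ∈ Ioo 0 t₀, u t = u' t)
    (w : UnitAddTorus d → EuclideanSpace ℝ d) (hw : MemLp w 2 volume) :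
    ∫ x, ⟪u t₀ x, w x⟫_ℝ = ∫ x, ⟪u' t₀ x, w x⟫_ℝ := by
  have hmem : t₀ ∈ Ioc 0 T := ⟨ht₀, ht₀T⟩
  have hsub : Ioo 0 t₀ ⊆ Ioc 0 T := fun t ht => ⟨ht.1, ht.2.le.trans ht₀T⟩
  have hg : Tendsto (fun t => ∫ x, ⟪u t x, w x⟫_ℝ) (𝓝[Ioo 0 t₀] t₀) (𝓝 (∫ x, ⟪u t₀ x, w x⟫_ℝ)) :=
    (((hu.weak_continuous w hw).1 t₀ hmem).mono hsub).tendsto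
  have hg' : Tendsto (fun t => ∫ x, ⟪u' t x, w x⟫_ℝ) (𝓝[Ioo 0 t₀] t₀) (𝓝 (∫ x, ⟪u' t₀ x, w x⟫_ℝ)) :=
    (((hu'.weak_continuous w hw).1 t₀ hmem).mono hsub).tendsto
  have heq : (fun t => ∫ x, ⟪u t x, w x⟫_ℝ) =ᶠ[𝓝[Ioo 0 t₀] t₀] fun t => ∫ x, ⟪u' t x, w x⟫_ℝ :=
    eventually_nhdsWithin_of_forall fun t ht => by simp only [h t ht]
  haveI := right_nhdsWithin_Ioo_neBot ht₀
  exact tendsto_nhds_unique (hg.congr' heq) hg'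

/-- **Slices at a positive time are pinned a.e.**  Two Leray–Hopf solutions on `[0, T]` agreeing on `(0, t₀)`,
`0 < t₀ ≤ T`, have a.e.-equal slices at `t₀`: pair the difference of the two `L²` slices with itself. [folklore] -/
theorem slice_ae_eq_of_eqOn_Ioo (hu : IsLerayHopfOn T ν F v₀ u) (hu' : IsLerayHopfOn T ν' F' v₀' u')
    (ht₀ : 0 < t₀) (ht₀T : t₀ ≤ T) (h : ∀ t ∈ Ioo 0 t₀, u t = u' t) :
    u t₀ =ᵐ[volume] u' t₀ := by
  have hIcc : t₀ ∈ Icc 0 T := ⟨ht₀.le, ht₀T⟩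
  have hU := hu.memLp t₀ hIcc
  have hU' := hu'.memLp t₀ hIcc
  set U : Lp (EuclideanSpace ℝ d) 2 (volume : Measure (UnitAddTorus d)) := hU.toLp (u t₀) with hUdef
  set U' : Lp (EuclideanSpace ℝ d) 2 (volume : Measure (UnitAddTorus d)) := hU'.toLp (u' t₀) with hU'def
  have hcoe : (U : UnitAddTorus d → EuclideanSpace ℝ d) =ᵐ[volume] u t₀ := hU.coeFn_toLp
  have hcoe' : (U' : UnitAddTorus d → EuclideanSpace ℝ d) =ᵐ[volume] u' t₀ := hU'.coeFn_toLp
  have key : ∀ G : Lp (EuclideanSpace ℝ d) 2 (volume : Measure (UnitAddTorus d)), ⟪U, G⟫_ℝ = ⟪U', G⟫_ℝ := by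
    intro G
    have h1 := slicePairing_eq_of_eqOn_Ioo hu hu' ht₀ ht₀T h G (Lp.memLp G)
    rw [L2.inner_def, L2.inner_def]
    calc ∫ x, ⟪U x, G x⟫_ℝ = ∫ x, ⟪u t₀ x, G x⟫_ℝ := integral_congr_ae (hcoe.mono fun x hx => by simp only [hx])
      _ = ∫ x, ⟪u' t₀ x, G x⟫_ℝ := h1
      _ = ∫ x, ⟪U' x, G x⟫_ℝ := integral_congr_ae (hcoe'.mono fun x hx => by simp only [hx])
  have hUU' : U = U' := by
    have h0 : ⟪U - U', U - U'⟫_ℝ = 0 := by rw [inner_sub_left, key (U - U'), sub_self]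
    exact sub_eq_zero.1 (inner_self_eq_zero.1 h0)
  have hcoeUU' : (U : UnitAddTorus d → EuclideanSpace ℝ d) = U' := by rw [hUU']
  exact hcoe.symm.trans (hcoeUU' ▸ hcoe')

/-- A Leray–Hopf solution on `[0, T]` cannot be altered at a single positive time `t₀ ≤ T` except on a null set:
if `u = u'` off `t₀` then `u t₀ = u' t₀` a.e. [folklore] -/
theorem slice_ae_eq_of_eq_off (hu : IsLerayHopfOn T ν F v₀ u) (hu' : IsLerayHopfOn T ν' F' v₀' u')
    (ht₀ : 0 < t₀) (ht₀T : t₀ ≤ T) (h : ∀ t, t ≠ t₀ → u t = u' t) :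
    u t₀ =ᵐ[volume] u' t₀ :=
  slice_ae_eq_of_eqOn_Ioo hu hu' ht₀ ht₀T fun t ht => h t ht.2.ne

/-- Global form: two global Leray–Hopf solutions (any viscosities, forces, data) that agree off a single time
`t₀ > 0` have a.e.-equal slices at `t₀` — the time-zero freedom of `sliceZero_eject` does not extend to any
positive time. [folklore] -/
theorem sliceGlobal_ae_eq_of_eq_off (hu : IsGlobalLerayHopf ν F v₀ u) (hu' : IsGlobalLerayHopf ν' F' v₀' u')
    (ht₀ : 0 < t₀) (h : ∀ t, t ≠ t₀ → u t = u' t) :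
    u t₀ =ᵐ[volume] u' t₀ :=
  slice_ae_eq_of_eq_off (hu t₀ ht₀) (hu' t₀ ht₀) ht₀ le_rfl h

end Summit.AnomalousDissipation.AnomalousDissipation.Theorems.SymmetricOrLoudPlanarStatesEject.Negative

end
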